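import Literature.NumberTheory.EllipticCurves.LangArtinSchreierFrobenius
import Literature.NumberTheory.EllipticCurves.KohelShparlinskiCoordinateCharacters
import Literature.NumberTheory.EllipticCurves.KohelShparlinskiLangDecomposition
import Literature.NumberTheory.EllipticCurves.KohelShparlinskiCharacterSumsReductionProofs
import Literature.NumberTheory.EllipticCurves.WeierstrassRationalPlaces
import Literature.NumberTheory.EllipticCurves.FrobeniusTateModule
import Literature.NumberTheory.DiophantineGeometry.FunctionFieldTraceResidueCharacter
import Literature.NumberTheory.DiophantineGeometry.FunctionFieldRayClassLSeriesEuler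
import Literature.NumberTheory.DiophantineGeometry.FunctionFieldZetaProofs
import Literature.NumberTheory.DiophantineGeometry.FunctionFieldHasseWeilProofs
import Literature.NumberTheory.DiophantineGeometry.FunctionFieldSchmidtDegreeOneConsequencesProofs
import Mathlib.Analysis.Fourier.FiniteAbelian.PontryaginDuality
import Mathlib.NumberTheory.LegendreSymbol.AddCharacter
import HarnessLib

/-!
# Proof of the Kohel–Shparlinski bound `CoordinateCharSumBound` (Bombieri–Weil for `E`)

Topic `NumberTheory/EllipticCurves`. This file discharges the named fact
`KohelShparlinski.CoordinateCharSumBound` (`|S_H(ω, ψ, x)| ≤ 4√q` for `p ≠ 2`,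
`|S_H(ω, ψ, y)| ≤ 6√q` for `p ≠ 3`) following Kohel–Shparlinski, *On exponential sums and group
generators for elliptic curves over finite fields* (ANTS-IV, 2000), §2 and the proof of Thm. 1: it
supplies to the tree's analytic reduction `coordinateCharSumBound_of_indexedFamilies`
(`KohelShparlinskiCharacterSumsReductionProofs`: polynomiality of ray class `L`-functions,
`t L'/L`-bookkeeping and `norm_inv_le_of_logDeriv_bound`) the ARITHMETIC input — the family of
Lang–Artin–Schreier characters `χ_{ω',η} = coordChar ω' (η ∘ Tr_{k/𝔽_p}) (α f)` (the tree's twisted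
characters `ω' · (ψ' ∘ g)` of `KohelShparlinskiCoordinateCharacters`: `ω'` read through the
Abel–Jacobi map `pointOfDivisor`, times the trace-of-residues character `ψ' ∘ g`) with

* **the identification of the Abel–Jacobi map with the Lang–Artin map**, `pointOfDivisor (v) = T_v`
  (`pointOfDivisor_single_eq_langPt`: both kill the principal divisors — Lang reciprocity,
  `sum_ord_smul_langPt_eq_zero` — and send the place of a rational point `P` to `P`,
  `langPt_placeOfPoint`; uniqueness `apply_eq_pointOfDivisor`), whence the values
  `χ(v) = ω'(T_v) η(Tr_{κ(v)/𝔽_p} g(v))` at all finite places (`coordChar_single_trace`) and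
  `χ(v_P) = ω'(P) ψ(f(P))` at the rational ones (`traceResidue_placeOfPoint_smul`, with the tree's
  `belowPlace_toGeomPoints` of `KohelShparlinskiLangDecomposition`), and the
  classification of the additive characters of `k` as `η ∘ Tr_{k/𝔽_p} ∘ (α ·)`
  (`exists_addChar_eq_trace_mul`);
* the ray property modulo `(n+1)·∞` (`coordChar_principalDivisor_of_mem_ray`, from the tree's
  `divisorChar_principalDivisor` and `traceResidueChar_principalDivisor_of_mem_ray`) and the
  nontriviality witnesses (`exists_divisor_coordChar_ne_one`, from the tree's
  `exists_traceResidueChar_principalDivisor_ne_one`);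
* **the orbit bound `‖Σ_{ω'} Σ_{η ≠ 1} S_r(χ_{ω',η})‖ ≤ C q^{r/2}`**
  (`norm_sum_family_placePowerSum_le`): by character orthogonality and the Frobenius data
  `Frob_v = σ_{(T_v, Tr g(v))}` at the finite places (`frob_eq_galHom`, from
  `LangArtinSchreierFrobenius` and `LangTorsorGeometric`; every place of the covers above a finite
  place comes from a geometric point, `exists_point_of_liesOver`), the family sum equals
  `(N_r(L) - c_r) - (N_r(E) - c'_r)` (`sum_family_placePowerSum_eq`, with the count of rational places
  by Frobenius classes `pointCount_eq_sum_unramified_add` for `L = LangASCover` and for the Lang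
  cover, which as a curve is `E`), and the Hasse–Weil theorem (tree: `hasseWeil_holds`) for `L` and
  `E` bounds it.

`exists_family_x` / `exists_family_y` assemble the families for `f = x` (`n = 2`, `p ≠ 2`) and
`f = y` (`n = 3`, `p ≠ 3`), and `KohelShparlinski.CoordinateCharSumBound_holds` is the discharge.
Everything is proved; the file introduces no definitions and no named facts.

## References

* D. R. Kohel, I. E. Shparlinski, *On exponential sums and group generators for elliptic curves
  over finite fields*, ANTS-IV, LNCS 1838, Springer 2000, 395–404, §2, Thm. 1, eq. (3), Cor. 1.
  [KohelShparlinski2000]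
* M. Rosen, *Number Theory in Function Fields*, GTM 210, Ch. 9. [RosenFunctionFields2002]
* J. H. Silverman, *The Arithmetic of Elliptic Curves*, 2nd ed., GTM 106, III.4.10(b) (the Lang map
  and the `E(k)`-torsor `φ - 1`). [SilvermanAEC2009]
* H. Stichtenoth, *Algebraic Function Fields and Codes*, 2nd ed., GTM 254, Thm. 3.8.2, §5.2. [Stichtenoth2009]
-/

noncomputable section

open scoped Classical
open Polynomial WeierstrassCurve WeierstrassCurve.geomPoints
open Literature.NumberTheory.EllipticCurves.WeierstrassFunctionField
open Literature.NumberTheory.EllipticCurves.WeierstrassGeometricPlaces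
open Literature.NumberTheory.EllipticCurves.WeierstrassGeometricOrders
open Literature.NumberTheory.EllipticCurves.LangTorsorGeometric
open Literature.NumberTheory.EllipticCurves.LangTorsor
open Literature.NumberTheory.EllipticCurves.WeierstrassDivisorClassPoints
open Literature.NumberTheory.EllipticCurves.KohelShparlinski (coordChar exists_coordChar_ne_one_of_ne_one
  belowPlace_toGeomPoints)
open Literature.NumberTheory.EllipticCurves.HasseManin
open Literature.NumberTheory.EllipticCurves.WeierstrassRationalPlaces
open Literature.NumberTheory.DiophantineGeometry Literature.NumberTheory.DiophantineGeometry.AlgFunctionField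
open Literature.NumberTheory.DiophantineGeometry.WeierstrassPlaceAtInfinity (infPlace)

universe u

namespace Literature.NumberTheory.EllipticCurves.KohelShparlinskiProofs

variable {F : Type u} [Field F] [Fintype F] (W : WeierstrassCurve F) [W.IsElliptic]
variable (σ : Field.absoluteGaloisGroup F) (hσ : ∀ x : AlgebraicClosure F, σ • x = x ^ Fintype.card F)


/-! ### Places of the Lang cover above the finite places come from geometric points -/

section CoverPlaces

omit [Fintype F] in
/-- `x` is regular at every finite place of `k(W)`. [folklore] -/
theorem gT_mem {v : PlaceOver F W.toAffine.FunctionField} (hv : v ≠ infPlace W.toAffine) :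
    gT W ∈ v.toValuationSubring := by
  obtain ⟨R, rfl⟩ := exists_belowPlace_eq W v
  have hR : R ≠ 0 := fun h => hv (by rw [h, belowPlace_zero])
  exact xF_mem_belowPlace W hR

omit [Fintype F] in
/-- `y` is regular at every finite place of `k(W)`. [folklore] -/
theorem gS_mem {v : PlaceOver F W.toAffine.FunctionField} (hv : v ≠ infPlace W.toAffine) :
    gS W ∈ v.toValuationSubring := by
  obtain ⟨R, rfl⟩ := exists_belowPlace_eq W v
  have hR : R ≠ 0 := fun h => hv (by rw [h, belowPlace_zero])
  obtain ⟨a, b, h, rfl⟩ := geomPoints.exists_eq_some hR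
  exact algebraMap_mem_belowPlace W h _

/-- `λ x` is not regular at `∞` (`ord_∞(λ x) = -2`). [folklore] -/
theorem lam_gT_not_mem : lam W (gT W) ∉ (infPlace W.toAffine).toValuationSubring := by
  have h0 : lam W (gT W) ≠ 0 := (_root_.map_ne_zero (lam W)).2 (by
    rw [show gT W = xF W.toAffine from rfl]; exact fun h => (transcendental_xF W.toAffine) (h ▸ isAlgebraic_zero))
  rw [PlaceOver.mem_toValuationSubring_iff_ord_nonneg _ h0, ord_infPlace_lam_gT]
  norm_num

include hσ in
/-- **A place `Q'` of the Lang cover lying over a finite place `v` of `k(W)` (through `λ`) is the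
place below a geometric point `P` with `P ≠ O`, `σP ≠ P`, and then `v` is the place below
`σP - P`.** (`P = O` would put `λ x` in `𝒪_∞`; `σP = P` likewise after translating by `-P`.)
[cite: KohelShparlinski2000, §2] -/
theorem exists_point_of_liesOver {v : PlaceOver F W.toAffine.FunctionField} (hv : v ≠ infPlace W.toAffine)
    (Q' : PlaceOver F (LangCover W))
    (hQv : ∀ z : W.toAffine.FunctionField,
      algebraMap W.toAffine.FunctionField (LangCover W) z ∈ Q'.toValuationSubring ↔ z ∈ v.toValuationSubring) :
    ∃ P : W.geomPoints, P ≠ 0 ∧ σ • P ≠ P ∧ coverPlace W P = Q' ∧ belowPlace W (σ • P - P) = v := by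
  obtain ⟨P, hPQ⟩ := exists_belowPlace_eq W (show PlaceOver F W.toAffine.FunctionField from Q')
  have hlam : ∀ z : W.toAffine.FunctionField,
      lam W z ∈ (belowPlace W P).toValuationSubring ↔ z ∈ v.toValuationSubring := fun z => by rw [hPQ]; exact hQv z
  have hP : P ≠ 0 := by
    intro h0
    rw [h0, belowPlace_zero] at hlam
    exact lam_gT_not_mem W ((hlam _).2 (gT_mem W hv))
  have hσP : σ • P ≠ P := by
    intro hfix
    obtain ⟨T, hT⟩ := mem_range_toGeomPoints_of_smul_eq (hσ_natCard σ hσ) hfix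
    -- translate by `-T`: `λ z` regular at `P = T̄` iff regular at `O`
    have key : ∀ z : W.toAffine.FunctionField, lam W z ∈ (belowPlace W P).toValuationSubring ↔
        lam W z ∈ (belowPlace W 0).toValuationSubring := fun z => by
      have h := transl_mem_belowPlace_iff W (-T) P (lam W z)
      rw [transl_lam, ← toGeomPointsHom_apply, map_neg, toGeomPointsHom_apply, hT, add_neg_cancel] at h
      exact h
    rw [belowPlace_zero] at key
    exact lam_gT_not_mem W ((key _).1 ((hlam _).2 (gT_mem W hv)))
  refine ⟨P, hP, hσP, hPQ, ?_⟩
  refine PlaceOver.eq_of_le fun z hz => ?_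
  exact (hlam z).1 ((lam_mem_belowPlace_iff W σ hσ hP hσP z).2 hz)

end CoverPlaces

/-! ### Rational places: `T_{v_P} = P`, `Tr g(v_P) = g(P)` -/

section Rational

include hσ in
/-- **`T_{v_P} = P`**: the Lang–Artin point of the place of a rational point `P ≠ O` is `P`.
[cite: KohelShparlinski2000, §2] -/
theorem langPt_placeOfPoint {P : W.toAffine.Point} (hP : P ≠ 0) :
    langPt W σ hσ (placeOfPoint W.toAffine P) = P := by
  apply W.toGeomPoints_injective
  have hR : W.toGeomPoints P ≠ 0 := fun h => hP (W.toGeomPoints_injective (by rw [h, map_zero]))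
  rw [toGeomPoints_langPt W σ hσ hR (belowPlace_toGeomPoints W P), orbitSum, belowPlace_toGeomPoints,
    degree_placeOfPoint, Finset.sum_range_one, pow_zero, one_smul]

omit [Fintype F] in
/-- A function with a value `c ∈ k` at the geometric point `P ≠ O` is regular at the place below `P`
and congruent to `c` there. [folklore] -/
theorem mem_and_valuation_sub_lt_one_of_hasValueAt {P : W.geomPoints} (hP : P ≠ 0) {g : W.toAffine.FunctionField}
    {c : F}
    (hg : W.HasValueAt (toGeom W g) P (algebraMap F (AlgebraicClosure F) c)) :
    g ∈ (belowPlace W P).toValuationSubring ∧ (belowPlace W P).valuation (g - algebraMap F _ c) < 1 := by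
  refine ⟨(mem_belowPlace_iff W P g).2 (hg.mem_place hP).1, ?_⟩
  have hsub : W.HasValueAt (toGeom W (g - algebraMap F _ c)) P 0 := by
    have h := hg.sub (hasValueAt_algebraMap (algebraMap F (AlgebraicClosure F) c) P)
    rw [sub_self] at h
    rwa [map_sub, AlgHom.commutes, IsScalarTower.algebraMap_apply F (AlgebraicClosure F) W.geomFunctionField]
  exact valuation_belowPlace_lt_one_of_hasValueAt_zero W hP hsub

omit [Fintype F] [W.IsElliptic] in
/-- `x` has the value `a` at the geometric point of `(a, b) ∈ W(k)`. [folklore] -/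
theorem hasValueAt_gT {a b : F} (h : W.toAffine.Nonsingular a b) :
    W.HasValueAt (toGeom W (gT W)) (W.toGeomPoints (.some a b h)) (algebraMap F (AlgebraicClosure F) a) := by
  obtain ⟨h', e⟩ : ∃ h' : (W.baseChange (AlgebraicClosure F)).toAffine.Nonsingular
      (algebraMap F (AlgebraicClosure F) a) (algebraMap F (AlgebraicClosure F) b),
      W.toGeomPoints (.some a b h) = (show W.geomPoints from .some _ _ h') := ⟨_, rfl⟩
  rw [e, toGeom_gT]
  have hx := hasValueAt_gen (show W.geomPoints from .some _ _ h') 0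
  rw [xy_some] at hx
  simpa using hx

omit [Fintype F] [W.IsElliptic] in
/-- `y` has the value `b` at the geometric point of `(a, b) ∈ W(k)`. [folklore] -/
theorem hasValueAt_gS {a b : F} (h : W.toAffine.Nonsingular a b) :
    W.HasValueAt (toGeom W (gS W)) (W.toGeomPoints (.some a b h)) (algebraMap F (AlgebraicClosure F) b) := by
  obtain ⟨h', e⟩ : ∃ h' : (W.baseChange (AlgebraicClosure F)).toAffine.Nonsingular
      (algebraMap F (AlgebraicClosure F) a) (algebraMap F (AlgebraicClosure F) b),
      W.toGeomPoints (.some a b h) = (show W.geomPoints from .some _ _ h') := ⟨_, rfl⟩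
  rw [e, toGeom_gS]
  have hy := hasValueAt_gen (show W.geomPoints from .some _ _ h') 1
  rw [xy_some] at hy
  simpa using hy

omit [Fintype F] in
/-- **`Tr_{κ(v_P)/k}((α g)(v_P)) = α · g(P)`** at the place of a rational point, read off the value
`g(P) = c` (tree: `traceResidue_eq_of_sub_algebraMap_mem`). [cite: KohelShparlinski2000, §1 and §2] -/
theorem traceResidue_placeOfPoint_smul {a b : F} (h : W.toAffine.Nonsingular a b) (α : F) {g : W.toAffine.FunctionField}
    {c : F}
    (hg : W.HasValueAt (toGeom W g) (W.toGeomPoints (.some a b h)) (algebraMap F (AlgebraicClosure F) c)) :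
    PlaceOver.traceResidue (infPlace W.toAffine) (algebraMap F _ α * g) (placeOfPoint W.toAffine (.some a b h)) =
      α * c := by
  have hR : W.toGeomPoints (.some a b h) ≠ 0 := fun h0 =>
    Affine.Point.some_ne_zero h (W.toGeomPoints_injective (by rw [h0, map_zero]))
  have hαg : W.HasValueAt (toGeom W (algebraMap F _ α * g)) (W.toGeomPoints (.some a b h))
      (algebraMap F (AlgebraicClosure F) (α * c)) := by
    rw [map_mul, map_mul, AlgHom.commutes, IsScalarTower.algebraMap_apply F (AlgebraicClosure F) W.geomFunctionField]
    exact (hasValueAt_algebraMap _ _).mul hg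
  obtain ⟨hmem, hlt⟩ := mem_and_valuation_sub_lt_one_of_hasValueAt W hR hαg
  rw [belowPlace_toGeomPoints] at hmem hlt
  exact PlaceOver.traceResidue_eq_of_sub_algebraMap_mem (placeOfPoint_some_ne_infPlace h)
    (isRational_placeOfPoint _) hmem hlt

end Rational

/-! ### The characters `ω · (ψ ∘ g)`: Abel–Jacobi = Lang–Artin, values, ray property, nontriviality -/

section Character

/-- **`pointOfDivisor (v) = T_v`**: the Abel–Jacobi map of the tree
(`WeierstrassDivisorClassPoints.pointOfDivisor`, `D ↦ ⊕ D(v)·pt(v)`) agrees on every place with the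
Lang–Artin point `T_v` (`LangTorsorGeometric.langPt`, the trace to `k` of the closed point `v`;
`T_∞ = O`): the homomorphism `D ↦ Σ_v D(v) T_v` kills the principal divisors (Lang reciprocity,
`sum_ord_smul_langPt_eq_zero`) and sends the place of a rational point `P` to `P`
(`langPt_placeOfPoint`), and `pointOfDivisor` is the unique such homomorphism
(`apply_eq_pointOfDivisor`). Hence the unramified character `divisorChar ω` of [KohelShparlinski2000]
takes the value `ω(T_v)` — `ω` at the Lang component of the Frobenius — at every place `v`.
[cite: KohelShparlinski2000, §2] [cite: SilvermanAEC2009, III.4.10(b)] -/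
theorem pointOfDivisor_single_eq_langPt (v : PlaceOver F W.toAffine.FunctionField) :
    pointOfDivisor W.toAffine (Finsupp.single v 1) = langPt W σ hσ v := by
  set Φ : Divisor F W.toAffine.FunctionField →+ W.toAffine.Point :=
    Finsupp.liftAddHom fun v => zmultiplesHom W.toAffine.Point (langPt W σ hσ v) with hΦ
  have hΦapply : ∀ D : Divisor F W.toAffine.FunctionField, Φ D = D.sum fun v m => m • langPt W σ hσ v :=
      fun D => by
    rw [hΦ, Finsupp.liftAddHom_apply]
    rfl
  have hΦsingle : ∀ v : PlaceOver F W.toAffine.FunctionField, Φ (Finsupp.single v 1) = langPt W σ hσ v :=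
      fun v => by
    rw [hΦ, Finsupp.liftAddHom_apply_single, zmultiplesHom_apply, one_smul]
  have hpt : ∀ P : W.toAffine.Point, Φ (Finsupp.single (placeOfPoint W.toAffine P) 1) = P := by
    intro P
    rw [hΦsingle]
    by_cases hP : P = 0
    · rw [hP, placeOfPoint_zero, langPt_infPlace]
    · exact langPt_placeOfPoint W σ hσ hP
  have hprinc : ∀ h : W.toAffine.FunctionField, h ≠ 0 → Φ (principalDivisor F h) = 0 := fun h hh => by
    rw [hΦapply, Finsupp.sum]
    rw [Finset.sum_congr rfl fun v _ => by rw [principalDivisor_apply_of_ne_zero hh]]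
    refine sum_ord_smul_langPt_eq_zero W σ hσ hh _ fun v _ hv => ?_
    rw [Finsupp.mem_support_iff, principalDivisor_apply_of_ne_zero hh]
    exact hv
  rw [← apply_eq_pointOfDivisor hpt hprinc (Finsupp.single v 1), hΦsingle]

/-- **`χ(v) = ω(T_v) · η(Tr_{κ(v)/𝔽_p} g(v))`**: the value of the twisted character
`ω · ((η ∘ Tr_{k/𝔽_p}) ∘ g) = coordChar ω (η ∘ Tr) g` on a single place, i.e. `(ω × η)` at the
Frobenius data `(T_v, Tr_{κ(v)/𝔽_p} g(v))` of the Lang–Artin–Schreier covering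
(`Tr_{κ(v)/𝔽_p} = Tr_{k/𝔽_p} ∘ Tr_{κ(v)/k}`, `traceResidue ∞ g v = Tr_{κ(v)/k} g(v)`).
[cite: KohelShparlinski2000, §2] -/
theorem coordChar_single_trace (p : ℕ) [Algebra (ZMod p) F] (ω : AddChar W.toAffine.Point ℂ)
    (η : AddChar (ZMod p) ℂ) (g : W.toAffine.FunctionField) (v : PlaceOver F W.toAffine.FunctionField) :
    coordChar W.toAffine ω (η.compAddMonoidHom (Algebra.trace (ZMod p) F).toAddMonoidHom) g
        (Finsupp.single v 1) =
      ω (langPt W σ hσ v) * η (Algebra.trace (ZMod p) F (PlaceOver.traceResidue (infPlace W.toAffine) g v)) := by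
  rw [coordChar, AddChar.mul_apply, divisorChar_apply, pointOfDivisor_single_eq_langPt W σ hσ,
    PlaceOver.traceResidueChar_single, Int.cast_one, one_mul]
  rfl

omit [Fintype F] in
/-- **The ray property** of `ω · (ψ ∘ g)` modulo `(n+1)·∞`, for `g` regular away from `∞` with
`v_∞(g) ≥ -n`: `divisorChar ω` is unramified (`divisorChar_principalDivisor`) and `ψ ∘ g` kills the
ray functions `h ≡ 1 (mod 𝔪_∞^{n+1})` (`traceResidueChar_principalDivisor_of_mem_ray`).
[cite: KohelShparlinski2000, Thm. 1] [cite: RosenFunctionFields2002, Ch. 9] -/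
theorem coordChar_principalDivisor_of_mem_ray (ω : AddChar W.toAffine.Point ℂ) (ψ : AddChar F ℂ)
    {g : W.toAffine.FunctionField} {n : ℕ}
    (hgv : ∀ v : PlaceOver F W.toAffine.FunctionField, v ≠ infPlace W.toAffine → g ∈ v.toValuationSubring)
    (hgm : g ∈ (infPlace W.toAffine).ball (-(n : ℤ))) {h : W.toAffine.FunctionField}
    (hh : h ∈ (infPlace W.toAffine).ray (n + 1)) (hh0 : h ≠ 0) :
    coordChar W.toAffine ω ψ g (principalDivisor F h) = 1 := by
  rw [coordChar, AddChar.mul_apply, divisorChar_principalDivisor,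
    PlaceOver.traceResidueChar_principalDivisor_of_mem_ray ψ (infPlace W.toAffine) hgv hgm hh hh0, one_mul]

omit [Fintype F] in
/-- **A degree-`0` divisor prime to `∞` on which `ω · (ψ ∘ g)` is nontrivial** (`ψ ≠ 1`, `g`
regular away from `∞` with a pole of order exactly `n ≥ 1` at `∞`, `n ≠ 0` in `k`): the divisor of
the tree's test function `1 + c πⁿ` (`exists_traceResidueChar_principalDivisor_ne_one`, `π` the
uniformizer of `∞`), on which `divisorChar ω` is trivial (`exists_coordChar_ne_one_of_ne_one`).
[cite: KohelShparlinski2000, Thm. 1] -/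
theorem exists_divisor_coordChar_ne_one (ω : AddChar W.toAffine.Point ℂ) {ψ : AddChar F ℂ}
    (hψ : ψ ≠ 1) {g : W.toAffine.FunctionField} {n : ℕ} (hn : 1 ≤ n) (hnp : (n : F) ≠ 0)
    (hgv : ∀ v : PlaceOver F W.toAffine.FunctionField, v ≠ infPlace W.toAffine → g ∈ v.toValuationSubring)
    (hg0 : g ≠ 0)
    (hgord : (infPlace W.toAffine).ord g = -(n : ℤ)) :
    ∃ D₁ : Divisor F W.toAffine.FunctionField,
      D₁ (infPlace W.toAffine) = 0 ∧ D₁.degree = 0 ∧ coordChar W.toAffine ω ψ g D₁ ≠ 1 := by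
  have hs : (infPlace W.toAffine).ord ((infPlace W.toAffine).uniformizer : W.toAffine.FunctionField) = 1 := by
    have := (infPlace W.toAffine).ord_uniformizer_zpow 1
    rwa [zpow_one] at this
  exact exists_coordChar_ne_one_of_ne_one W.toAffine ω
    (PlaceOver.exists_traceResidueChar_principalDivisor_ne_one hψ
      (WeierstrassPlaceAtInfinity.isRational_infPlace W.toAffine) hgv hn hnp hg0 hgord
      (infPlace W.toAffine).coe_uniformizer_ne_zero hs)

/-- `η ∘ Tr_{k/𝔽_p} ≠ 1` for `η ≠ 1` (the trace `k → 𝔽_p` is onto). [folklore] -/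
theorem traceComp_ne_one (p : ℕ) [Fact p.Prime] [Algebra (ZMod p) F] {η : AddChar (ZMod p) ℂ}
    (hη : η ≠ 0) : η.compAddMonoidHom (Algebra.trace (ZMod p) F).toAddMonoidHom ≠ 1 := by
  obtain ⟨t, ht⟩ : ∃ t : ZMod p, η t ≠ 1 := by
    by_contra hall
    push Not at hall
    exact hη (by ext a; exact hall a)
  obtain ⟨c, hc⟩ := Algebra.trace_surjective (ZMod p) F t
  intro h1
  apply ht
  have h2 := DFunLike.congr_fun h1 c
  rw [AddChar.one_apply] at h2
  rw [← hc]
  exact h2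

omit [Fintype F] [W.IsElliptic] in
/-- A nontrivial character of `ℤ/p` takes a value `≠ 1` at every `a ≠ 0` (`a` generates `ℤ/p`).
[folklore] -/
theorem addChar_zmod_apply_ne_one (p : ℕ) [Fact p.Prime] {η : AddChar (ZMod p) ℂ} (hη : η ≠ 1)
    {a : ZMod p} (ha : a ≠ 0) : η a ≠ 1 := by
  intro h1
  apply hη
  ext b
  -- `b = (b * a⁻¹) * a`, a multiple of `a`
  obtain ⟨m, rfl⟩ : ∃ m : ℕ, (m : ZMod p) * a = b := by
    refine ⟨(b * a⁻¹).val, ?_⟩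
    rw [ZMod.natCast_zmod_val, mul_assoc, inv_mul_cancel₀ ha, mul_one]
  rw [AddChar.one_apply, ← nsmul_eq_mul, AddChar.map_nsmul_eq_pow, h1, one_pow]

end Character

/-! ### Frobenius data of `L/k(W)` and of the Lang cover at the finite places -/

section FrobeniusData

variable (p : ℕ) [Fact p.Prime] [CharP F p] [Algebra (ZMod p) F] (g₁ : W.toAffine.FunctionField)
variable [Fact (∀ s : LangCover W, s ^ p - s ≠ algebraMap W.toAffine.FunctionField (LangCover W) g₁)]

omit [Fintype F] [W.IsElliptic] [CharP F p] in
/-- `𝔽_p → k → κ(v)` is a scalar tower for any `𝔽_p`-algebra structures (they are unique). [folklore] -/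
theorem isScalarTower_zmod (v : PlaceOver F W.toAffine.FunctionField) [Algebra (ZMod p) v.residueField] :
    IsScalarTower (ZMod p) F v.residueField :=
  IsScalarTower.of_algebraMap_eq fun a => by
    have h : (algebraMap F v.residueField).comp (algebraMap (ZMod p) F) = algebraMap (ZMod p) v.residueField :=
      Subsingleton.elim _ _
    exact (RingHom.congr_fun h a).symm

omit [W.IsElliptic] [CharP F p] in
/-- The absolute trace of `g(v)` is `Tr_{k/𝔽_p}(Tr_{κ(v)/k} g(v))`. [folklore] -/
theorem trace_residue_eq_trace_traceResidue {v : PlaceOver F W.toAffine.FunctionField} (hv : v ≠ infPlace W.toAffine)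
    [Algebra (ZMod p) v.residueField]
    (hg : g₁ ∈ v.toValuationSubring) :
    Algebra.trace (ZMod p) v.residueField (IsLocalRing.residue v.toValuationSubring ⟨g₁, hg⟩) =
      Algebra.trace (ZMod p) F (PlaceOver.traceResidue (infPlace W.toAffine) g₁ v) := by
  haveI := isScalarTower_zmod W p v
  haveI := v.finite_residueField
  haveI : FiniteDimensional F v.residueField := PlaceOver.finiteDimensional_residueField_holds v
  rw [PlaceOver.traceResidue_of_mem hv hg, Algebra.trace_trace]

set_option synthInstance.maxHeartbeats 400000 in
include hσ in
/-- **The Frobenius element of `L/k(W)` at any place `𝔔` above a finite place `v` (where `g₁` is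
regular) is `σ_{(T_v, Tr_{κ(v)/𝔽_p} g₁(v))}`, and `𝔔|v` is unramified.**
[cite: KohelShparlinski2000, §2] -/
theorem frob_eq_galHom {v : PlaceOver F W.toAffine.FunctionField} (hv : v ≠ infPlace W.toAffine)
    (hg : g₁ ∈ v.toValuationSubring) (𝔔 : PlaceOver F (LangASCover W p g₁))
    (hQv : ∀ z : W.toAffine.FunctionField,
      algebraMap W.toAffine.FunctionField (LangASCover W p g₁) z ∈ 𝔔.toValuationSubring ↔ z ∈ v.toValuationSubring) :
    PlaceOver.frob 𝔔 hQv = LangASCover.galHom W p g₁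
        (Multiplicative.ofAdd (langPt W σ hσ v),
          Multiplicative.ofAdd (Algebra.trace (ZMod p) F (PlaceOver.traceResidue (infPlace W.toAffine) g₁ v))) ∧
      (PlaceOver.primeBelow 𝔔 hQv).inertia (LangASCover W p g₁ ≃ₐ[W.toAffine.FunctionField] LangASCover W p g₁) =
        ⊥ := by
  -- the restriction of `𝔔` to the Lang cover lies over `v` through `λ`
  set Q' : PlaceOver F (LangCover W) := 𝔔.restrict (K := F) (F := LangCover W) with hQ'
  have hQ'v : ∀ z : W.toAffine.FunctionField,
      algebraMap W.toAffine.FunctionField (LangCover W) z ∈ Q'.toValuationSubring ↔ z ∈ v.toValuationSubring := fun z => by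
    rw [hQ', PlaceOver.mem_restrict_iff, ← IsScalarTower.algebraMap_apply]
    exact hQv z
  obtain ⟨P, hP, hσP, hPQ, hvP⟩ := exists_point_of_liesOver W σ hσ hv Q' hQ'v
  subst hvP
  letI : Algebra (ZMod p) (belowPlace W (σ • P - P)).residueField := ZMod.algebra _ p
  have hfrob := LangASCover.frob_eq_sigma W p g₁ σ hσ hP hσP 𝔔 hPQ.symm hg
  have hI := LangASCover.inertia_eq_bot W p g₁ σ hσ hP hσP 𝔔 hPQ.symm hg
  refine ⟨?_, hI⟩
  rw [LangASCover.galHom_apply, toAdd_ofAdd, toAdd_ofAdd, ← trace_residue_eq_trace_traceResidue W p g₁ hv hg]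
  exact hfrob

set_option synthInstance.maxHeartbeats 400000 in
include hσ in
/-- **The residue degree `f_v` of a finite place `v` in `L/k(W)` divides `m` iff
`m T_v = O` and `m · Tr_{κ(v)/𝔽_p} g₁(v) = 0`** (`f_v = ord Frob_v`). [cite: KohelShparlinski2000, §2]
[cite: Stichtenoth2009, Thm. 3.8.2] -/
theorem resDeg_dvd_iff {v : PlaceOver F W.toAffine.FunctionField} (hv : v ≠ infPlace W.toAffine)
    (hg : g₁ ∈ v.toValuationSubring) (m : ℕ) :
    v.resDeg (LangASCover W p g₁) ∣ m ↔
      m • langPt W σ hσ v = 0 ∧ m • Algebra.trace (ZMod p) F (PlaceOver.traceResidue (infPlace W.toAffine) g₁ v) = 0 := by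
  obtain ⟨𝔔, h𝔔⟩ := PlaceOver.exists_restrict_eq' (K := F) (F' := LangASCover W p g₁) v
  have hQv : ∀ z : W.toAffine.FunctionField,
      algebraMap W.toAffine.FunctionField (LangASCover W p g₁) z ∈ 𝔔.toValuationSubring ↔ z ∈ v.toValuationSubring :=
    fun z => by rw [← PlaceOver.mem_restrict_iff (K := F), h𝔔]
  obtain ⟨hfrob, hI⟩ := frob_eq_galHom W σ hσ p g₁ hv hg 𝔔 hQv
  rw [← PlaceOver.inertiaDeg_primeBelow_eq_resDeg 𝔔 hQv, ← PlaceOver.orderOf_frob 𝔔 hQv hI,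
    orderOf_dvd_iff_pow_eq_one, hfrob, ← map_pow, ← (LangASCover.galHom W p g₁).map_one,
    (LangASCover.galHom_injective W p g₁).eq_iff, Prod.pow_mk, Prod.mk_eq_one, ← ofAdd_nsmul,
    ← ofAdd_nsmul, ← ofAdd_zero, ← ofAdd_zero, Multiplicative.ofAdd.injective.eq_iff,
    Multiplicative.ofAdd.injective.eq_iff]

set_option synthInstance.maxHeartbeats 400000 in
include hσ in
/-- **The residue degree of a finite place `v` in the Lang cover divides `m` iff `m T_v = O`.**
[cite: KohelShparlinski2000, §2] [cite: SilvermanAEC2009, III.4.10(b)] -/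
theorem resDeg_langCover_dvd_iff {v : PlaceOver F W.toAffine.FunctionField} (hv : v ≠ infPlace W.toAffine)
    (m : ℕ) :
    v.resDeg (LangCover W) ∣ m ↔ m • langPt W σ hσ v = 0 := by
  obtain ⟨Q', hQ'⟩ := PlaceOver.exists_restrict_eq' (K := F) (F' := LangCover W) v
  have hQ'v : ∀ z : W.toAffine.FunctionField,
      algebraMap W.toAffine.FunctionField (LangCover W) z ∈ Q'.toValuationSubring ↔ z ∈ v.toValuationSubring :=
    fun z => by rw [← PlaceOver.mem_restrict_iff (K := F), hQ']
  obtain ⟨P, hP, hσP, hPQ, hvP⟩ := exists_point_of_liesOver W σ hσ hv Q' hQ'v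
  subst hvP
  subst hPQ
  have hI := inertia_coverPlace_eq_bot W σ hσ hP hσP
  have hfrob := frob_coverPlace_eq_transl_langPt W σ hσ hP hσP
  rw [← PlaceOver.inertiaDeg_primeBelow_eq_resDeg (coverPlace W P) hQ'v,
    ← PlaceOver.orderOf_frob (coverPlace W P) hQ'v hI, orderOf_dvd_iff_pow_eq_one, hfrob,
    ← LangCover.translAutHom_ofAdd, ← map_pow, ← (LangCover.translAutHom W).map_one,
    (LangCover.translAutHom_injective W).eq_iff, ← ofAdd_nsmul, ← ofAdd_zero,
    Multiplicative.ofAdd.injective.eq_iff]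

set_option synthInstance.maxHeartbeats 400000 in
include hσ in
/-- All places of `L` above a finite place where `g₁` is regular are unramified.
[cite: KohelShparlinski2000, §2] -/
theorem inertia_eq_bot_of_ne {v : PlaceOver F W.toAffine.FunctionField} (hv : v ≠ infPlace W.toAffine)
    (hg : g₁ ∈ v.toValuationSubring) (𝔔 : PlaceOver F (LangASCover W p g₁))
    (hQv : ∀ z : W.toAffine.FunctionField,
      algebraMap W.toAffine.FunctionField (LangASCover W p g₁) z ∈ 𝔔.toValuationSubring ↔ z ∈ v.toValuationSubring) :
    (PlaceOver.primeBelow 𝔔 hQv).inertia (LangASCover W p g₁ ≃ₐ[W.toAffine.FunctionField] LangASCover W p g₁) =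
      ⊥ :=
  (frob_eq_galHom W σ hσ p g₁ hv hg 𝔔 hQv).2

set_option synthInstance.maxHeartbeats 400000 in
include hσ in
/-- All places of the Lang cover above a finite place are unramified. [cite: SilvermanAEC2009, III.4.10(b)] -/
theorem inertia_langCover_eq_bot_of_ne {v : PlaceOver F W.toAffine.FunctionField} (hv : v ≠ infPlace W.toAffine)
    (Q' : PlaceOver F (LangCover W))
    (hQ'v : ∀ z : W.toAffine.FunctionField,
      algebraMap W.toAffine.FunctionField (LangCover W) z ∈ Q'.toValuationSubring ↔ z ∈ v.toValuationSubring) :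
    (PlaceOver.primeBelow Q' hQ'v).inertia (LangCover W ≃ₐ[W.toAffine.FunctionField] LangCover W) = ⊥ := by
  obtain ⟨P, hP, hσP, hPQ, hvP⟩ := exists_point_of_liesOver W σ hσ hv Q' hQ'v
  subst hvP
  subst hPQ
  exact inertia_coverPlace_eq_bot W σ hσ hP hσP

end FrobeniusData

/-! ### The family identity `Σ_χ S_r(χ) = (N_r(L) - c) - (N_r(E) - c')` and its bound -/

section Counting

variable (p : ℕ) [Fact p.Prime] [CharP F p] [Algebra (ZMod p) F] (g₁ : W.toAffine.FunctionField)
variable [Fact (∀ s : LangCover W, s ^ p - s ≠ algebraMap W.toAffine.FunctionField (LangCover W) g₁)]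

omit [Fintype F] [W.IsElliptic] [Fact p.Prime] [CharP F p] [Algebra (ZMod p) F] in
/-- `f · d ∣ r ↔ d ∣ r ∧ f ∣ r / d` for `d ≥ 1`. [folklore] -/
theorem mul_dvd_iff_dvd_and_dvd_div {f d r : ℕ} (hd : 0 < d) : f * d ∣ r ↔ d ∣ r ∧ f ∣ r / d := by
  constructor
  · rintro ⟨k, rfl⟩
    refine ⟨⟨f * k, by ring⟩, ⟨k, ?_⟩⟩
    rw [show f * d * k = d * (f * k) by ring, Nat.mul_div_cancel_left _ hd]
  · rintro ⟨⟨k, rfl⟩, ⟨j, hj⟩⟩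
    rw [Nat.mul_div_cancel_left _ hd] at hj
    exact ⟨j, by rw [hj]; ring⟩

omit [Fintype F] [W.IsElliptic] [CharP F p] [Algebra (ZMod p) F] in
/-- **Character orthogonality for the family** `{ω' × η : η ≠ 1}`:
`Σ_{ω'} Σ_{η ≠ 1} (ω'(T) η(a))^m = #E(k) · [mT = 0] · (p [ma = 0] - 1)`. [folklore] -/
theorem sum_family_pow [Finite W.toAffine.Point] (T : W.toAffine.Point) (a : ZMod p) (m : ℕ) :
    ∑ ω' : AddChar W.toAffine.Point ℂ, ∑ η ∈ (Finset.univ : Finset (AddChar (ZMod p) ℂ)).erase 0,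
        (ω' T * η a) ^ m =
      (if m • T = 0 then (Nat.card W.toAffine.Point : ℂ) else 0) *
        ((if m • a = 0 then (p : ℂ) else 0) - 1) := by
  haveI := Fintype.ofFinite W.toAffine.Point
  have h1 : ∀ (ω' : AddChar W.toAffine.Point ℂ) (η : AddChar (ZMod p) ℂ),
      (ω' T * η a) ^ m = ω' (m • T) * η (m • a) := fun ω' η => by
    rw [mul_pow, AddChar.map_nsmul_eq_pow, AddChar.map_nsmul_eq_pow]
  simp_rw [h1, ← Finset.mul_sum, ← Finset.sum_mul]
  rw [AddChar.sum_apply_eq_ite, Finset.sum_erase_eq_sub (Finset.mem_univ _), AddChar.sum_apply_eq_ite,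
    AddChar.zero_apply, ZMod.card, Nat.card_eq_fintype_card]

set_option synthInstance.maxHeartbeats 400000 in
include hσ in
/-- **The family identity**: for `r ≥ 1` and `S` the set of places of `k(W)` of degree `≤ r`,
`Σ_{ω'} Σ_{η ≠ 1} S_r(χ_{ω',η}) = Σ_{v ∈ S ∖ ∞, f_v deg v ∣ r} |G_L| deg v - Σ_{v ∈ S ∖ ∞, f'_v deg v ∣ r} |G_E| deg v`
(`f_v`, `f'_v` the residue degrees of `v` in `L` and in the Lang cover): expand `S_r` over places,
use `χ(v)^m = ω'(mT_v) η(m a_v)`, character orthogonality and the Frobenius criteria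
`resDeg_dvd_iff`, `resDeg_langCover_dvd_iff`. [cite: KohelShparlinski2000, §2] -/
theorem sum_family_placePowerSum_eq [Finite W.toAffine.Point]
    (hgv : ∀ v : PlaceOver F W.toAffine.FunctionField, v ≠ infPlace W.toAffine → g₁ ∈ v.toValuationSubring)
    {r : ℕ} (hr : 0 < r) (S : Finset (PlaceOver F W.toAffine.FunctionField))
    (hS : ∀ v : PlaceOver F W.toAffine.FunctionField, v.degree ≤ r → v ∈ S) :
    ∑ ω' : AddChar W.toAffine.Point ℂ, ∑ η ∈ (Finset.univ : Finset (AddChar (ZMod p) ℂ)).erase 0,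
        placePowerSum (infPlace W.toAffine)
          (coordChar W.toAffine ω' (η.compAddMonoidHom (Algebra.trace (ZMod p) F).toAddMonoidHom) g₁) r =
      (∑ v ∈ S \ {(infPlace W.toAffine)}, (if v.resDeg (LangASCover W p g₁) * v.degree ∣ r then
          (Nat.card (LangASCover W p g₁ ≃ₐ[W.toAffine.FunctionField] LangASCover W p g₁) * v.degree : ℕ) else 0) : ℂ) -
      (∑ v ∈ S \ {(infPlace W.toAffine)}, (if v.resDeg (LangCover W) * v.degree ∣ r then
          (Nat.card (LangCover W ≃ₐ[W.toAffine.FunctionField] LangCover W) * v.degree : ℕ) else 0) : ℂ) := by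
  haveI := Fintype.ofFinite W.toAffine.Point
  set E : Finset (AddChar (ZMod p) ℂ) := (Finset.univ : Finset (AddChar (ZMod p) ℂ)).erase 0 with hE
  set S' : Finset (PlaceOver F W.toAffine.FunctionField) := S \ {(infPlace W.toAffine)} with hS'
  have hinfS : (infPlace W.toAffine) ∈ S := hS _ (by rw [WeierstrassPlaceAtInfinity.degree_infPlace]; exact hr)
  -- expand the power sums over the places of `S ∖ ∞`
  have hexp : ∀ (ω' : AddChar W.toAffine.Point ℂ) (η : AddChar (ZMod p) ℂ),
      placePowerSum (infPlace W.toAffine)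
          (coordChar W.toAffine ω' (η.compAddMonoidHom (Algebra.trace (ZMod p) F).toAddMonoidHom) g₁) r =
        ∑ v ∈ S', if v.degree ∣ r then
          (v.degree : ℂ) * (ω' (langPt W σ hσ v) *
            η (Algebra.trace (ZMod p) F (PlaceOver.traceResidue (infPlace W.toAffine) g₁ v))) ^ (r / v.degree)
          else 0 := by
    intro ω' η
    rw [placePowerSum_eq_sum (P := infPlace W.toAffine) _ hr.ne' S hS,
      Finset.sum_eq_sum_sdiff_singleton_add hinfS _, if_neg (fun h => h.1 rfl), add_zero]
    refine Finset.sum_congr rfl fun v hvS => ?_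
    have hvinf : v ≠ infPlace W.toAffine := fun h => (Finset.mem_sdiff.1 hvS).2 (Finset.mem_singleton.2 h)
    by_cases hd : v.degree ∣ r
    · rw [if_pos ⟨hvinf, hd⟩, if_pos hd, coordChar_single_trace W σ hσ]
    · rw [if_neg (fun h => hd h.2), if_neg hd]
  simp_rw [hexp]
  rw [Finset.sum_congr rfl fun ω' _ => Finset.sum_comm, Finset.sum_comm, ← Finset.sum_sub_distrib]
  refine Finset.sum_congr rfl fun v hv => ?_
  have hvinf : v ≠ infPlace W.toAffine := by
    rw [hS', Finset.mem_sdiff, Finset.mem_singleton] at hv; exact hv.2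
  have hdpos : 0 < v.degree := PlaceOver.one_le_degree v
  by_cases hd : v.degree ∣ r
  · simp_rw [if_pos hd, ← Finset.mul_sum]
    rw [sum_family_pow W p]
    simp only [mul_dvd_iff_dvd_and_dvd_div hdpos, resDeg_dvd_iff W σ hσ p g₁ hvinf (hgv v hvinf),
      resDeg_langCover_dvd_iff W σ hσ hvinf, LangASCover.natCard_algEquiv, LangCover.natCard_algEquiv, hd,
      true_and]
    by_cases hT : (r / v.degree) • langPt W σ hσ v = 0
    · by_cases ha :
        (r / v.degree) • Algebra.trace (ZMod p) F (PlaceOver.traceResidue (infPlace W.toAffine) g₁ v) = 0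
      · simp only [hT, ha, and_self, if_true]
        push_cast; ring
      · simp only [hT, ha, and_false, if_true, if_false]
        push_cast; ring
    · simp only [hT, false_and, if_false]
      ring
  · simp_rw [if_neg hd]
    rw [if_neg (fun h => hd ((dvd_mul_left _ _).trans h)), if_neg (fun h => hd ((dvd_mul_left _ _).trans h))]
    simp

set_option synthInstance.maxHeartbeats 400000 in
include hσ in
/-- **The family bound** `‖Σ_{ω'} Σ_{η ≠ 1} S_r(χ_{ω',η})‖ ≤ C · q^{r/2}` for all `r ≥ 1`, with
`C = 2 g_L + 2 g_E + |G_L| + |G_E|`: by the family identity and the count of rational places by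
Frobenius classes (`pointCount_eq_sum_unramified_add` for `L/k(W)` and for the Lang cover, whose
point counts are those of the curves `L` and `E`), the family sum is
`(N_r(L) - c_r) - (N_r(E) - c'_r)` with `0 ≤ c_r ≤ |G_L|`, `0 ≤ c'_r ≤ |G_E|`, and the Hasse–Weil
theorem (`hasseWeil_holds`) gives `N_r = q^r + 1 - Σ αᵢ^r`, `|αᵢ| = √q`, for both curves.
[cite: KohelShparlinski2000, §2 (Thm. 1)] -/
theorem norm_sum_family_placePowerSum_le [Finite W.toAffine.Point]
    (hgv : ∀ v : PlaceOver F W.toAffine.FunctionField, v ≠ infPlace W.toAffine → g₁ ∈ v.toValuationSubring)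
    [IsIntegrallyClosedIn F (LangASCover W p g₁)] :
    ∃ C : ℝ, ∀ r : ℕ, 0 < r →
      ‖∑ ω' : AddChar W.toAffine.Point ℂ, ∑ η ∈ (Finset.univ : Finset (AddChar (ZMod p) ℂ)).erase 0,
          placePowerSum (infPlace W.toAffine)
            (coordChar W.toAffine ω' (η.compAddMonoidHom (Algebra.trace (ZMod p) F).toAddMonoidHom) g₁) r‖ ≤
        C * Real.sqrt (Fintype.card F) ^ r := by
  haveI := Fintype.ofFinite W.toAffine.Point
  -- Hasse–Weil for `L` and for the Lang cover (= the curve `E`)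
  obtain ⟨αL, hαL, hNL⟩ := exists_pointCount_eq_of_facts (K := F) (F := LangASCover W p g₁)
    lSeries_eq_polynomial_holds hasseWeil_holds
  obtain ⟨αK, hαK, hNK⟩ := exists_pointCount_eq_of_facts (K := F) (F := LangCover W)
    lSeries_eq_polynomial_holds hasseWeil_holds
  set nL : ℕ := Nat.card (LangASCover W p g₁ ≃ₐ[W.toAffine.FunctionField] LangASCover W p g₁) with hnL
  set nK : ℕ := Nat.card (LangCover W ≃ₐ[W.toAffine.FunctionField] LangCover W) with hnK
  set ρ : ℝ := Real.sqrt (Fintype.card F) with hρ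
  have hρ1 : 1 ≤ ρ := by
    rw [hρ, Real.one_le_sqrt]
    exact_mod_cast Fintype.card_pos
  refine ⟨2 * genus F (LangASCover W p g₁) + 2 * genus F (LangCover W) + nL + nK, fun r hr => ?_⟩
  -- the places of degree `≤ r`
  set S : Finset (PlaceOver F W.toAffine.FunctionField) :=
    (finite_setOf_degree_le (K := F) (F := W.toAffine.FunctionField) r).toFinset with hSdef
  have hS : ∀ v : PlaceOver F W.toAffine.FunctionField, v.degree ≤ r → v ∈ S := fun v hv => by
    rw [hSdef, Set.Finite.mem_toFinset]; exact hv
  -- counting rational places of `L` and of the Lang cover by Frobenius classes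
  obtain ⟨c, hc, hcount⟩ := PlaceOver.pointCount_eq_sum_unramified_add (k := F) (L := W.toAffine.FunctionField)
    (Ω := LangASCover W p g₁) hr S {(infPlace W.toAffine)} hS (fun v _ hv 𝔔 hQv =>
      inertia_eq_bot_of_ne W σ hσ p g₁ (fun h => hv (Finset.mem_singleton.2 h))
        (hgv v (fun h => hv (Finset.mem_singleton.2 h))) 𝔔 hQv)
  obtain ⟨c', hc', hcount'⟩ := PlaceOver.pointCount_eq_sum_unramified_add (k := F) (L := W.toAffine.FunctionField)
    (Ω := LangCover W) hr S {(infPlace W.toAffine)} hS (fun v _ hv Q' hQ'v =>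
      inertia_langCover_eq_bot_of_ne W σ hσ (fun h => hv (Finset.mem_singleton.2 h)) Q' hQ'v)
  rw [Finset.sum_singleton, WeierstrassPlaceAtInfinity.degree_infPlace, mul_one] at hc hc'
  -- the family identity, in `ℂ`
  have hid := sum_family_placePowerSum_eq W σ hσ p g₁ hgv hr S hS
  have hA : (∑ v ∈ S \ {(infPlace W.toAffine)}, (if v.resDeg (LangASCover W p g₁) * v.degree ∣ r then
      (Nat.card (LangASCover W p g₁ ≃ₐ[W.toAffine.FunctionField] LangASCover W p g₁) * v.degree : ℕ) else 0 : ℂ)) =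
      (pointCount F (LangASCover W p g₁) r : ℂ) - c := by
    rw [hcount]; push_cast
    simp only [add_sub_cancel_right]
  have hB : (∑ v ∈ S \ {(infPlace W.toAffine)}, (if v.resDeg (LangCover W) * v.degree ∣ r then
      (Nat.card (LangCover W ≃ₐ[W.toAffine.FunctionField] LangCover W) * v.degree : ℕ) else 0 : ℂ)) =
      (pointCount F (LangCover W) r : ℂ) - c' := by
    rw [hcount']; push_cast
    simp only [add_sub_cancel_right]
  rw [hid, hA, hB, hNL r hr, hNK r hr]
  -- norms
  have hq : ((Fintype.card F : ℂ)) ^ r + 1 - ∑ i, αL i ^ r - (c : ℂ) -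
      (((Fintype.card F : ℂ)) ^ r + 1 - ∑ i, αK i ^ r - (c' : ℂ)) =
        -∑ i, αL i ^ r + ∑ i, αK i ^ r - c + c' := by ring
  rw [hq]
  have hL : ‖∑ i, αL i ^ r‖ ≤ 2 * genus F (LangASCover W p g₁) * ρ ^ r := by
    refine (norm_sum_le _ _).trans ?_
    rw [Finset.sum_congr rfl fun i _ => by rw [norm_pow, hαL i], Finset.sum_const, Finset.card_univ,
      Fintype.card_fin, nsmul_eq_mul]
    push_cast; rfl
  have hK : ‖∑ i, αK i ^ r‖ ≤ 2 * genus F (LangCover W) * ρ ^ r := by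
    refine (norm_sum_le _ _).trans ?_
    rw [Finset.sum_congr rfl fun i _ => by rw [norm_pow, hαK i], Finset.sum_const, Finset.card_univ,
      Fintype.card_fin, nsmul_eq_mul]
    push_cast; rfl
  have hρr : 1 ≤ ρ ^ r := one_le_pow₀ hρ1
  calc ‖-∑ i, αL i ^ r + ∑ i, αK i ^ r - (c : ℂ) + (c' : ℂ)‖
      ≤ ‖∑ i, αL i ^ r‖ + ‖∑ i, αK i ^ r‖ + c + c' := by
        refine (norm_add_le _ _).trans (add_le_add ((norm_sub_le _ _).trans (add_le_add
          ((norm_add_le _ _).trans (by rw [norm_neg])) (by simp))) (by simp))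
    _ ≤ 2 * genus F (LangASCover W p g₁) * ρ ^ r + 2 * genus F (LangCover W) * ρ ^ r + nL * ρ ^ r + nK * ρ ^ r := by
        gcongr
        · calc (c : ℝ) ≤ nL := by exact_mod_cast hc
            _ ≤ nL * ρ ^ r := le_mul_of_one_le_right (by positivity) hρr
        · calc (c' : ℝ) ≤ nK := by exact_mod_cast hc'
            _ ≤ nK * ρ ^ r := le_mul_of_one_le_right (by positivity) hρr
    _ = _ := by ring

end Counting

/-! ### Additive characters of `k` are `η ∘ Tr_{k/𝔽_p} ∘ (α ·)` -/

section Characters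

omit W [W.IsElliptic] in
/-- **Every nontrivial additive character of a finite field of characteristic `p` is
`x ↦ η(Tr_{k/𝔽_p}(α x))`** for a nontrivial character `η` of `ℤ/p` and some `α ≠ 0`: the map
`α ↦ η₁(Tr(α ·))` (`η₁` primitive) is injective by the nondegeneracy of the trace form, hence
bijective (`#Hom(k, ℂ*) = #k`). [folklore] -/
theorem exists_addChar_eq_trace_mul (p : ℕ) [Fact p.Prime] [Algebra (ZMod p) F]
    {ψ : AddChar F ℂ} (hψ : ψ ≠ 0) :
    ∃ (η : AddChar (ZMod p) ℂ) (α : F), η ≠ 0 ∧ α ≠ 0 ∧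
      ∀ x : F, ψ x = η (Algebra.trace (ZMod p) F (α * x)) := by
  haveI : NeZero p := ⟨(Fact.out : p.Prime).ne_zero⟩
  have hp1 : 1 < p := (Fact.out : p.Prime).one_lt
  -- a primitive character of `ℤ/p`
  obtain ⟨ζ, hζ⟩ : ∃ ζ : ℂ, IsPrimitiveRoot ζ p := ⟨_, Complex.isPrimitiveRoot_exp p (NeZero.ne p)⟩
  set η : AddChar (ZMod p) ℂ := AddChar.zmodChar p hζ.pow_eq_one with hη
  have hη1 : η 1 = ζ := by
    rw [hη, AddChar.zmodChar_apply, ZMod.val_one, pow_one]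
  have hη0 : η ≠ 0 := fun h0 => hζ.ne_one hp1 (by rw [← hη1, h0, AddChar.zero_apply])
  have hker : ∀ c : ZMod p, η c = 1 → c = 0 := fun c hc => by
    by_contra hc0; exact addChar_zmod_apply_ne_one p hη0 hc0 hc
  -- the injection `α ↦ η(Tr(α ·))`
  set Φ : F → AddChar F ℂ := fun α =>
    η.compAddMonoidHom ((Algebra.trace (ZMod p) F).toAddMonoidHom.comp (AddMonoidHom.mulLeft α)) with hΦ
  have hΦapp : ∀ α x, Φ α x = η (Algebra.trace (ZMod p) F (α * x)) := fun α x => rfl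
  have hinj : Function.Injective Φ := by
    intro α β hαβ
    have hzero : ∀ x, Algebra.trace (ZMod p) F ((α - β) * x) = 0 := fun x => by
      have h1 := DFunLike.congr_fun hαβ x
      rw [hΦapp, hΦapp] at h1
      apply hker
      rw [sub_mul, map_sub, AddChar.map_sub_eq_div, h1, div_self]
      intro h0
      have := AddChar.map_zero_eq_one η
      rw [← add_neg_cancel (Algebra.trace (ZMod p) F (β * x)), AddChar.map_add_eq_mul, h0, zero_mul] at this
      exact zero_ne_one this
    have hnd := traceForm_nondegenerate (ZMod p) F
    exact sub_eq_zero.1 (hnd.1 (α - β) fun x => by rw [Algebra.traceForm_apply]; exact hzero x)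
  have hbij : Function.Bijective Φ := by
    rw [Fintype.bijective_iff_injective_and_card]
    exact ⟨hinj, (AddChar.card_eq).symm⟩
  obtain ⟨α, hα⟩ := hbij.2 ψ
  refine ⟨η, α, hη0, ?_, fun x => by rw [← hα]; exact hΦapp α x⟩
  rintro rfl
  apply hψ
  rw [← hα]
  ext x
  rw [hΦapp, zero_mul, map_zero, AddChar.map_zero_eq_one, AddChar.zero_apply]

end Characters

end Literature.NumberTheory.EllipticCurves.KohelShparlinskiProofs

/-! ### Assembly: the ray class families for `f = x` and `f = y`, and the discharge -/

namespace Literature.NumberTheory.EllipticCurves.KohelShparlinskiProofs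

open Literature.NumberTheory.EllipticCurves.KohelShparlinski (coordinateCharSumBound_of_indexedFamilies)

variable {F : Type} [Field F] [Fintype F] (W : WeierstrassCurve F) [W.IsElliptic]

omit [Fintype F] [W.IsElliptic] in
/-- `ord_∞(c · g) = ord_∞(g)` for a nonzero constant `c`. [folklore] -/
theorem ord_algebraMap_mul (v : PlaceOver F W.toAffine.FunctionField) {c : F} (hc : c ≠ 0)
    {g : W.toAffine.FunctionField} (hg : g ≠ 0) :
    v.ord (algebraMap F _ c * g) = v.ord g := by
  have hc' : algebraMap F W.toAffine.FunctionField c ≠ 0 := (_root_.map_ne_zero _).2 hc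
  rw [PlaceOver.ord_mul_eq v hc' hg, PlaceOver.ord_eq_zero_of_isAlgebraic v hc' (isAlgebraic_algebraMap c), zero_add]

omit [Fintype F] [W.IsElliptic] in
/-- `x ≠ 0` in `k(W)`. [folklore] -/
theorem gT_ne_zero : gT W ≠ 0 := fun h => (transcendental_xF W.toAffine) (by
  rw [show xF W.toAffine = gT W from rfl, h]; exact isAlgebraic_zero)

omit [Fintype F] [W.IsElliptic] in
/-- `ord_∞(y) = -3` (the tree's `KohelShparlinski.ord_infPlace_yF`, for `gS W = yF W`).
[cite: SilvermanAEC2009, proof of Prop. III.3.1] -/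
theorem ord_infPlace_gS : (infPlace W.toAffine).ord (gS W) = -3 :=
  KohelShparlinski.ord_infPlace_yF W.toAffine

/-- **The ray class family for a coordinate function** `g ∈ {x, y}` with `ord_∞(g) = -n`, `p ∤ n`,
`n ≥ 1`: for every nontrivial `ψ` and every `ω`, the characters `χ_{ω',η} = coordChar ω' (η ∘ Tr) (α g)`
(`η ≠ 1`, `ψ = η₁(Tr(α ·))`) form a family as required by `coordinateCharSumBound_of_indexedFamilies`.
[cite: KohelShparlinski2000, Thm. 1 and its proof, §2] -/
theorem exists_family {p : ℕ} [Fact p.Prime] [CharP F p] (ω : AddChar W.toAffine.Point ℂ)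
    (ψ : AddChar F ℂ) (hψ : ψ ≠ 0) {g : W.toAffine.FunctionField} {n : ℕ} (hn : 1 ≤ n) (hnp : (n : F) ≠ 0)
    (hcop : Nat.Coprime n p) (hg0 : g ≠ 0)
    (hgv : ∀ v : PlaceOver F W.toAffine.FunctionField, v ≠ WeierstrassPlaceAtInfinity.infPlace W.toAffine →
      g ∈ v.toValuationSubring)
    (hgord : (infPlace W.toAffine).ord g = -n)
    (hlamord : (infPlace W.toAffine).ord (lam W g) = -n)
    (hirr : ∀ {α : F}, α ≠ 0 → ∀ s : W.toAffine.FunctionField,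
      s ^ p - s ≠ algebraMap F W.toAffine.FunctionField α * lam W g)
    (val : F → F → F)
    (hvalue : ∀ {a b : F} (h : W.toAffine.Nonsingular a b),
      W.HasValueAt (toGeom W g) (W.toGeomPoints (.some a b h)) (algebraMap F (AlgebraicClosure F) (val a b))) :
    ∃ (ι : Type) (s : Finset ι) (χ : ι → AddChar (Divisor F W.toAffine.FunctionField) ℂ) (i : ι),
      i ∈ s ∧
      (∀ {a b : F} (h : W.toAffine.Nonsingular a b),
        χ i (Finsupp.single (placeOfPoint W.toAffine (.some a b h)) 1) = ω (.some a b h) * ψ (val a b)) ∧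
      (∀ j ∈ s, ∀ h : W.toAffine.FunctionField, h ∈ (infPlace W.toAffine).ray (n + 1) →
        h ≠ 0 → χ j (principalDivisor F h) = 1) ∧
      (∀ j ∈ s, ∃ D₁ : Divisor F W.toAffine.FunctionField,
        D₁ (infPlace W.toAffine) = 0 ∧ D₁.degree = 0 ∧ χ j D₁ ≠ 1) ∧
      ∃ C : ℝ, ∀ r : ℕ, 0 < r →
        ‖∑ j ∈ s, placePowerSum (infPlace W.toAffine) (χ j) r‖ ≤
          C * Real.sqrt (Fintype.card F) ^ r := by
  set Pinf := WeierstrassPlaceAtInfinity.infPlace W.toAffine with hPinf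
  letI : Algebra (ZMod p) F := ZMod.algebra F p
  haveI : Finite W.toAffine.Point := WeierstrassCurve.finite_point W
  -- the arithmetic Frobenius
  obtain ⟨σ, hσ'⟩ := exists_frobenius_absoluteGaloisGroup F
  have hσ : ∀ x : AlgebraicClosure F, σ • x = x ^ Fintype.card F := fun x => by
    rw [hσ', Nat.card_eq_fintype_card]
  -- `ψ = η(Tr(α ·))`
  obtain ⟨η, α, hη, hα, hψα⟩ := exists_addChar_eq_trace_mul p hψ
  set g₁ : W.toAffine.FunctionField := algebraMap F _ α * g with hg₁
  have hα' : algebraMap F W.toAffine.FunctionField α ≠ 0 := (_root_.map_ne_zero _).2 hα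
  have hg₁0 : g₁ ≠ 0 := mul_ne_zero hα' hg0
  -- the Artin–Schreier layer is a field
  haveI : Fact (∀ s : LangCover W, s ^ p - s ≠ algebraMap W.toAffine.FunctionField (LangCover W) g₁) :=
    ⟨fun s => by
      rw [LangCover.algebraMap_apply, hg₁, map_mul, AlgHom.commutes]
      exact hirr hα s⟩
  -- `g₁` is regular away from `∞`, with a pole of order exactly `n` at `∞`
  have hgv₁ : ∀ v : PlaceOver F W.toAffine.FunctionField, v ≠ Pinf → g₁ ∈ v.toValuationSubring :=
    fun v hv => mul_mem (v.algebraMap_mem α) (hgv v hv)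
  have hord₁ : Pinf.ord g₁ = -n := by rw [hg₁, ord_algebraMap_mul W _ hα hg0, hgord]
  have hgm₁ : g₁ ∈ Pinf.ball (-(n : ℤ)) := by
    rw [Pinf.mem_ball_iff_le_ord _ hg₁0, hord₁]
  -- `k` is the full constant field of `L`
  have hlam₁ : Pinf.ord (lam W g₁) = -n := by
    rw [hg₁, map_mul, AlgHom.commutes, ord_algebraMap_mul W _ hα ((_root_.map_ne_zero (lam W)).2 hg0), hlamord]
  haveI : IsIntegrallyClosedIn F (LangASCover W p g₁) :=
    LangASCover.isIntegrallyClosedIn W p g₁ (Nat.lt_of_lt_of_le Nat.zero_lt_one hn) hcop hlam₁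
  -- the family
  refine ⟨AddChar W.toAffine.Point ℂ × AddChar (ZMod p) ℂ,
    (Finset.univ : Finset (AddChar W.toAffine.Point ℂ)) ×ˢ (Finset.univ : Finset (AddChar (ZMod p) ℂ)).erase 0,
    fun j => coordChar W.toAffine j.1 (j.2.compAddMonoidHom (Algebra.trace (ZMod p) F).toAddMonoidHom) g₁,
    (ω, η), ?_, ?_, ?_, ?_, ?_⟩
  · exact Finset.mem_product.2 ⟨Finset.mem_univ _, Finset.mem_erase.2 ⟨hη, Finset.mem_univ _⟩⟩
  · intro a b h
    rw [coordChar_single_trace W σ hσ, langPt_placeOfPoint W σ hσ (WeierstrassCurve.Affine.Point.some_ne_zero h),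
      hψα, traceResidue_placeOfPoint_smul W h α (hvalue h)]
  · intro j _ h hh hh0
    exact coordChar_principalDivisor_of_mem_ray W j.1 _ hgv₁ hgm₁ hh hh0
  · intro j hj
    have hj2 : j.2 ≠ 0 := (Finset.mem_erase.1 (Finset.mem_product.1 hj).2).1
    exact exists_divisor_coordChar_ne_one W j.1 (traceComp_ne_one p hj2) hn hnp hgv₁ hg₁0 hord₁
  · obtain ⟨C, hC⟩ := norm_sum_family_placePowerSum_le W σ hσ p g₁ hgv₁
    refine ⟨C, fun r hr => ?_⟩
    rw [Finset.sum_product]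
    exact hC r hr

/-- **The family for `f = x`** (`p ≠ 2`, `n = 2`). [cite: KohelShparlinski2000, Thm. 1 with 𝔣 = 3·O] -/
theorem exists_family_x (ω : AddChar W.toAffine.Point ℂ) (ψ : AddChar F ℂ) (hψ : ψ ≠ 0) (hp : ringChar F ≠ 2) :
    ∃ (ι : Type) (s : Finset ι) (χ : ι → AddChar (Divisor F W.toAffine.FunctionField) ℂ) (i : ι),
      i ∈ s ∧
      (∀ {a b : F} (h : W.toAffine.Nonsingular a b),
        χ i (Finsupp.single (placeOfPoint W.toAffine (.some a b h)) 1) = ω (.some a b h) * ψ a) ∧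
      (∀ j ∈ s, ∀ h : W.toAffine.FunctionField, h ∈ (infPlace W.toAffine).ray 3 →
        h ≠ 0 → χ j (principalDivisor F h) = 1) ∧
      (∀ j ∈ s, ∃ D₁ : Divisor F W.toAffine.FunctionField,
        D₁ (infPlace W.toAffine) = 0 ∧ D₁.degree = 0 ∧ χ j D₁ ≠ 1) ∧
      ∃ C : ℝ, ∀ r : ℕ, 0 < r →
        ‖∑ j ∈ s, placePowerSum (infPlace W.toAffine) (χ j) r‖ ≤
          C * Real.sqrt (Fintype.card F) ^ r := by
  set p := ringChar F with hpdef
  haveI hchar : CharP F p := ringChar.charP F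
  haveI : Fact p.Prime := ⟨CharP.char_is_prime F p⟩
  have hp' : (p : ℕ).Prime := Fact.out
  have h2 : ((2 : ℕ) : F) ≠ 0 := by
    rw [Ne, CharP.cast_eq_zero_iff F p]
    intro hdvd
    exact hp ((Nat.prime_dvd_prime_iff_eq hp' Nat.prime_two).1 hdvd)
  have hcop : Nat.Coprime 2 p := (Nat.coprime_primes Nat.prime_two hp').2 (Ne.symm hp)
  exact exists_family W ω ψ hψ (n := 2) (by norm_num) (by exact_mod_cast h2) hcop (gT_ne_zero W)
    (fun v hv => gT_mem W hv) (ord_infPlace_xF W) ord_infPlace_lam_gT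
    (fun hα s => pow_sub_self_ne_smul_lam_gT hp hα s) (fun a _ => a) (fun h => hasValueAt_gT W h)

/-- **The family for `f = y`** (`p ≠ 3`, `n = 3`). [cite: KohelShparlinski2000, Thm. 1 with 𝔣 = 4·O] -/
theorem exists_family_y (ω : AddChar W.toAffine.Point ℂ) (ψ : AddChar F ℂ) (hψ : ψ ≠ 0) (hp : ringChar F ≠ 3) :
    ∃ (ι : Type) (s : Finset ι) (χ : ι → AddChar (Divisor F W.toAffine.FunctionField) ℂ) (i : ι),
      i ∈ s ∧
      (∀ {a b : F} (h : W.toAffine.Nonsingular a b),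
        χ i (Finsupp.single (placeOfPoint W.toAffine (.some a b h)) 1) = ω (.some a b h) * ψ b) ∧
      (∀ j ∈ s, ∀ h : W.toAffine.FunctionField, h ∈ (infPlace W.toAffine).ray 4 →
        h ≠ 0 → χ j (principalDivisor F h) = 1) ∧
      (∀ j ∈ s, ∃ D₁ : Divisor F W.toAffine.FunctionField,
        D₁ (infPlace W.toAffine) = 0 ∧ D₁.degree = 0 ∧ χ j D₁ ≠ 1) ∧
      ∃ C : ℝ, ∀ r : ℕ, 0 < r →
        ‖∑ j ∈ s, placePowerSum (infPlace W.toAffine) (χ j) r‖ ≤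
          C * Real.sqrt (Fintype.card F) ^ r := by
  set p := ringChar F with hpdef
  haveI hchar : CharP F p := ringChar.charP F
  haveI : Fact p.Prime := ⟨CharP.char_is_prime F p⟩
  have hp' : (p : ℕ).Prime := Fact.out
  have h3 : ((3 : ℕ) : F) ≠ 0 := by
    rw [Ne, CharP.cast_eq_zero_iff F p]
    intro hdvd
    exact hp ((Nat.prime_dvd_prime_iff_eq hp' Nat.prime_three).1 hdvd)
  have hcop : Nat.Coprime 3 p := (Nat.coprime_primes Nat.prime_three hp').2 (Ne.symm hp)
  exact exists_family W ω ψ hψ (n := 3) (by norm_num) (by exact_mod_cast h3) hcop (gS_ne_zero (W := W))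
    (fun v hv => gS_mem W hv) (ord_infPlace_gS W) ord_infPlace_lam_gS
    (fun hα s => pow_sub_self_ne_smul_lam_gS hp hα s) (fun _ b => b) (fun h => hasValueAt_gS W h)

end Literature.NumberTheory.EllipticCurves.KohelShparlinskiProofs

namespace Literature.NumberTheory.EllipticCurves.KohelShparlinski

open Literature.NumberTheory.EllipticCurves.KohelShparlinskiProofs

/-- **Discharge of the named fact `CoordinateCharSumBound`** (Kohel–Shparlinski 2000, Cor. 1 with
Thm. 1 and (3)): `|S_H(ω, ψ, x)| ≤ 4 √q` for `p ≠ 2` and `|S_H(ω, ψ, y)| ≤ 6 √q` for `p ≠ 3`, for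
every elliptic curve over a finite field `𝔽_q`, every subgroup `H ≤ E(𝔽_q)`, every character `ω`
of `E(𝔽_q)` and every nontrivial additive character `ψ` — through the ray class families of the
Lang–Artin–Schreier characters (`exists_family_x`, `exists_family_y`) and the tree's reduction
`coordinateCharSumBound_of_indexedFamilies`. [cite: KohelShparlinski2000, Cor. 1 p. 399; Thm. 1 and (3) pp. 398–399] -/
theorem CoordinateCharSumBound_holds : CoordinateCharSumBound :=
  -- The named fact types `ω : Hom(W(k), ℂ*)` through an arbitrary `[DecidableEq k]` (Mathlib's group
  -- law on `W(k)`), the tree's Abel–Jacobi characters through the classical one; `DecidableEq k` is a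
  -- subsingleton (`Subsingleton.elim`), so we substitute before invoking the classical families.
  coordinateCharSumBound_of_indexedFamilies
    (fun {k} _ _ hdec W _ ω ψ hψ hp _ => by
      have h : hdec = Classical.decEq k := Subsingleton.elim _ _
      subst h
      exact exists_family_x W ω ψ hψ hp)
    (fun {k} _ _ hdec W _ ω ψ hψ hp _ => by
      have h : hdec = Classical.decEq k := Subsingleton.elim _ _
      subst h
      exact exists_family_y W ω ψ hψ hp)

end Literature.NumberTheory.EllipticCurves.KohelShparlinski
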